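import Summits.ResolutionOfSingularities.ResolutionOfSingularities.Theorems.PurityCutLeaf
import HarnessLib

/-!
# PurityCutClasses — decomp-res node «PurityCut» (lens-2 g16 rev 1), file 1/2 of `PurityCutClasses`

Content VERBATIM from the decomp-res lens-2 g16 node `HOME/decomp-res-lens-2/g16/PurityCut.lean` rev 1 (pin c1c78f8a
= `parts/PurityCut-rev1-c1c78f8a.lean`, 2 025 l;
HOME = run/shared/lean/pub/decomp-res; CRITIC-LEDGER row 140 CLEARED; landing orders INBOX :288 (row-140 line: split
/ order / asides) and :296 (land from rev 1:
docstring-only changes + eight ring-identity kernels).  The lens's §R (l. 121–1020: 89 declarations RESTATED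
VERBATIM-IN-BODY from lens-2 g14 `PinchCut` rev 1 and
g15 `JetCut` rev 5) is DELETED — those are the tree's `PinchCutClasses` / `PinchCutKernels` / `JetCut*` modules
(namespaces `…Theorems.PinchCut`, `…Theorems.JetCut`
with its sub-namespace `Vast`, opened; same short names, byte-identical bodies — never two copies).  Namespace
`…Theorems.PurityCut` (the lens's `Theses.PurityCut`
is gate-reserved), sub-namespaces `Leaf` / `Grand` as in the lens; file split only (tree files ≤ 400 lines):
sections, variables and every declaration exactly as in
the lens.  Node files, in import order: `PurityCutLeaf` (§G) · `PurityCutClasses` (§P, continued `…2` / `…3` as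
needed) · `PurityCutGrand` (§H cone-free: the aside
home) · the wiring `MaxContactCutPurityCut` (§G/§H BY NAME on the host route, in the Theses cone).  All `--supports
stmt-ResolutionOfSingularities-29273`
(`MaxContactCut.RungOne`); nothing closes 29273 — decided halves carry their engines as hypotheses; exactly ONE
located-residual aside is booked on the route for
the lens-2 column (`Grand.GrandSpecialRung`, home `PurityCutGrand`), SUPERSEDING the JetCut residual
`Vast.VastSpecialRung` (critic :288: «if Vast is not yet filed,
file Grand only; never both») and re-locating the tree aside 33866 `LeafSpecialRung` EXACTLY modulo the grand decided half.

§P (NEW, g16; rev 1): the PURE LADDER (D⁺) — the `n ∣ k` COMPLETION of g15's degenerate-vertex ladder (D), typed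
UNIFORMLY along the top curve with the LAST-STAGE A-POINT (STRAY) CLAUSE: `StrayClean`, `PureLadderShape`,
`IsPureLadderAt`, `IsUniformPureLadderCurve`, ENGINE (D⁺) `def PureLadderExit : Prop` (EXACT-ON-PAPER, carried as a
hypothesis like the other five engines), `IsPureLadderCurvePt`, the GRAND leaf classes `IsGrandCurvePt` /
`GrandExit` / `IsGrandSpecialPt`, and the ring KERNELS `pure_depth`, `stray_no_gap`, `stray_pair_values`,
`frobenius_exact_three`, `bridge_core` / `unit_presentation`, `bridge_unit_clause_value` + rev 1's eight
ring-identity kernels `pure_translate` / `represent_S5` / `represent_P3` / `represent_P5` / `represent_P7a` /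
`represent_P7b` / `represent_P8` / `root_S5` (PROVED) — VERBATIM; the 95-line §P law prose of rev 0 lives in
HOME/decomp-res-lens-2/g16/NODE-g16.md (archive), the tree keeps the short rev-1 docstrings.

Part 1/2 carries: `pure_depth`, `pure_last_identity`, `wtIdeal_zero_le_span`, `pure_weight_last`, `stray_no_gap`,
`frobenius_exact_three`, `bridge_core_presentation`, `bridge_unit_presentation`, `bridge_unit_clause_value`,
`stray_pair_values`, `pure_translate`, `represent_S5`, `represent_P3`, `represent_P5`, `represent_P7a`,
`represent_P7b`, `represent_P8`, `root_S5`.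

(Sources: Hironaka1964 Ch. III; CossartJannsenSaito2020 Ch. 2, Ch. 8–9; CossartPiltant2008 Prop. 4.2;
CossartPiltant2019 Rem. 3.2; BierstoneGrigorievMilmanWlodarczyk2011 §3.1; Moh1987; Hauser2010Kangaroo; Giraud1975;
Narasimhan1983; HunekeSwanson2006 Cor. 5.5.5.)
-/

open CategoryTheory AlgebraicGeometry TopologicalSpace IsLocalRing
open Literature.AlgebraicGeometry.Resolution
open Summit.ResolutionOfSingularities.ResolutionOfSingularities.Theorems
open Summit.ResolutionOfSingularities.ResolutionOfSingularities.Theorems.WeakOrderReduction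
open Summit.ResolutionOfSingularities.ResolutionOfSingularities.Theorems.DeltaFaceCutClasses
open Summit.ResolutionOfSingularities.ResolutionOfSingularities.Theorems.RelativeDeltaCut
open Summit.ResolutionOfSingularities.ResolutionOfSingularities.Theorems.CurveLeafExit
open Summit.ResolutionOfSingularities.ResolutionOfSingularities.Theorems.PinchCut
open Summit.ResolutionOfSingularities.ResolutionOfSingularities.Theorems.JetCut

namespace Summit.ResolutionOfSingularities.ResolutionOfSingularities.Theorems.PurityCut

section PureKernel

/-! ## §P  NEW (g16): the PURE LADDER (D⁺) — the `n ∣ k` COMPLETION of g15's degenerate-vertex ladder (D), typed UNIFORMLY along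
the top curve, with the LAST-STAGE STRAY CLAUSE (critic row 133 window, item (i)/(D⁺); g15 NEXT-g16 §(D⁺) ANATOMY).

THE CLASS (at a closed point `y′` of the top curve `C`, germ dimension 4, `I` PRINCIPAL at `y′`): a regular system of parameters
`(z, U, W; π)` with `C = V(z, U, W)`, `π` a local parameter of `C` at `y′`, `A := 𝒪_{C,y′} = 𝒪_{Y,y′}/(z, U, W)` (a DVR,
uniformiser `π̄`, residue field `κ = κ(y′)`), and a generator of PURE LADDER SHAPE
  `f = zⁿ + β·Uⁿ + π^m·ε·W^k + h`,  `ε` a unit,  `n ∣ k`,  `n ≤ k`,  `1 ≤ m < n`,  `h ∈ Wt(nk+1)`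
(rev 3's weight IDEAL verbatim: spanned by the monomials `z^a U^b W^e` with `(a+b)k + e·n ≥ nk+1`, ARBITRARY ring coefficients),
the cone coefficient `β` EITHER `= π` (a CORE point) OR a unit, rev 3's `SideClean`, at a core `3 ≤ n`, and the A-POINT (STRAY)
CLAUSE:  IF every middle binomial `C(n,i)`, `0 < i < n`, lies in `𝔪` (the GUARD: `n` is a power of `char κ`) THEN
  `∀ x₀ x₁ ∈ 𝒪_{Y,y′}:  x₀ⁿ + β·x₁ⁿ + π^m·ε ∉ (z, U, W) + 𝔪ⁿ`   (i.e. `v_A(x̄₀ⁿ + β̄x̄₁ⁿ + π̄^m ε̄) ≤ n − 1` on `A²`).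
The exponent `m` is EXISTENTIAL PER POINT (the bridge bed has `m = 2` at its core and `m = 1` elsewhere); `(n, k)` is uniform
along `C`.  By letter DISJOINT in presentation from (L)/(L′)/(D) (those have `n ∤ k`).  The `n ∣ k` UNIT-leader case `ε₀W^k`
enters the class AFTER ABSORBING an `n`-th root of `ε̄₀` (`z ↦ z + s̃W^{k/n}` in characteristic `p = n`; bridge bed).

THE LAW (paper; EXACT-ON-PAPER, bookkeeping KERNEL; exits by ORDER only — no `τ`; frame: `Y` regular of finite type over a
field, ANY characteristic, ANY residue fields).
(0) `ord_{y′} f = n = ord_η f` (every tail monomial has degree `a+b+e ≥ n+1` since `(a+b+e)k ≥ (a+b)k + en ≥ nk+1`), so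
    `C ⊆ Top(I)` is a permissible centre.  Put `j = k/n` (`pure_depth`).
(1) ONE BLOW-UP of `C` with current exponent `K ∈ {k, k−n, …, n}`.  `W`-chart: `f′ = X₀ⁿ + βX₁ⁿ + π^m ε W^{K−n} + h′`,
    `h′ ∈ Wt′(n(K−n)+1)`, every monomial of `h′` divisible by `W` (`ladder_chart_identity` with `ε ↦ π^m ε` — the weights are
    blind to the coefficient — `ladder_monomial_identity`, `ladder_weight_step`, `pure_weight_last`); `z`- and `U`-charts:
    `ladder_sidechart_identity`.  The exceptional divisor is `E = ℙ²_C`; over `y′` the transform `f′` modulo the exceptional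
    parameter is the FORM `𝚽 = Zⁿ + β̄Uⁿ + [π̄^m ε̄ Wⁿ]_{K = n} ∈ A[Z, U, W]_n` and for a closed point `q` of the fibre `ℙ²_κ`:
    `ord_q f′ ≤ ord_q 𝚽` (computed in the regular 3-dimensional ring `𝒪_{E,q}`; a `W`-divisible tail form never cancels a
    lowest form of `𝚽` of `w`-degree `0`, so tails can only LOWER these orders).
(1a) `K > n` (a PERFORMED stage): `𝚽 = Zⁿ + β̄Uⁿ` — rev 3's fibre analysis VERBATIM: CORE (`β̄ = π̄`): `z ≠ 0` unit; `(0:x₁:w)`,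
    `x₁ ≠ 0`: `π̄·unit + X₀ⁿ`, order 1; UNIT `β`: off `{zⁿ + b uⁿ = 0}` unit, on it (then `zu ≠ 0`) `ord_q 𝚽 =
ord_{Q̄}(1 + β̄Tⁿ)
    ≤ 1` by `SideClean` (`Q̄` the point of `Spec A[T]`, `T = U/Z`, under `q`; a flat local extension with regular
fibre preserves
    orders).  So the near locus over `C` is exactly the SECTION CURVE `C′ = V(X₀, X₁, W) ≅ C` (non-closed points:
semicontinuity +
    density of closed points in a scheme of finite type over a field), regular, inside `Top(f′)`, and at its points
`f′` has pure
    ladder shape with exponent `K − n` and the SAME `β, π, ε, m` — the side and clause data are elements of `A ≅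
𝒪_{C′,y″}` and do
    not change.  ITERATE.
(1b) `K = n` (the LAST blow-up, the `j`-th): `𝚽 = Zⁿ + β̄Uⁿ + π̄^m ε̄ Wⁿ`.  SECTION point: `Φ := X₀ⁿ + β̄X₁ⁿ + π̄^m ε̄` has the
    lowest form `ε̄(y′)ϖ^m`: ORDER `m < n`.  Line `w = 0`: `U`-chart `X₀′ⁿ + β̄ + θ̄W′ⁿ` at `W′ = 0`: order `≤ 1`
(`π̄` linear at a
    core; `SideClean` at a unit point, `θ̄W′ⁿ` having order `≥ n + m ≥ 3`); `z`-chart point `(1:0:0)`: unit.  The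
other points of
    the `W`-chart, `Φ ∈ A[X₀, X₁]`:
    CORE: `Φ = X₀ⁿ + π̄·G`, `G = X₁ⁿ + π̄^{m−1}ε̄`; `x̄₀ ≠ 0`: unit; `x̄₀ = 0`, `x̄₁ ≠ 0`: for `m ≥ 2` order 1.  For `m = 1`
    (`G = X₁ⁿ + ε̄`): `q ↔` an irreducible `ρ ∣ Ḡ = Tⁿ + ε̄(y′) ∈ κ[T]` of multiplicity `μ ≥ 1` (else `G(q) ≠ 0`, order 1).
    STRAY LEMMA: `ord_q Φ ≤ μ + 1` (`G = ρ̃^μ σ + π̄γ`, `σ(q) ≠ 0`; the forms `x₀ⁿ`, `σ(q)ϖr^μ`, `ϖ²(…)` have `ϖ`-degrees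
    `0, 1, ≥ 2`: no cancellation).  GAP LEMMA (`stray_no_gap`, KERNEL in binomial form): `μ ≥ n − 1 ≥ 2` forces `deg ρ = 1`,
    `ρ = T − a`, `a ≠ 0`, and by Hasse derivatives `C(n,i)a^{n−i} = 0` (`1 ≤ i ≤ n−2`), hence `C(n,1) = 0 =
C(n,n−1)` too: `μ = n`,
    `Ḡ = (T − a)ⁿ`, and the GUARD holds (`(T−a)ⁿ = Tⁿ + (−a)ⁿ` iff all middle binomials vanish).  So for `n ≥ 3` EITHER
    `μ ≤ n − 2` — EXIT (order `≤ n − 1`) — OR guard + rational root: then (the frame ring is an `𝔽_p`-algebra) `G =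
(X₁ − ã)ⁿ + δ`
    EXACTLY with `δ = ãⁿ + ε̄ ∈ π̄A`, and `ord_q Φ = min(n, 1 + v_A(δ))` (`ϖ`-degrees `0`, `n+1`, `1+v`).  For `n = 2` the gap
    value `μ = 1 = n − 1` occurs (`ord_q Φ = 2 = n`, census P7a/P7b): cores need `3 ≤ n`.
    UNIT `β`: off `{x₀ⁿ + b x₁ⁿ = 0}` unit; on it `x̄₀x̄₁ ≠ 0`, `Φ = X₀ⁿ·Ψ`, `Ψ = 1 + β̄Tⁿ + π̄^m ε̄ X₀^{−n}`, `T =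
X₁/X₀`, `q` over
    `Q̄ = (π̄, τ̃)`, `τ ∣ 1 + bTⁿ` of multiplicity `μ`, `1 + β̄Tⁿ = τ̃^μ σ + π̄u`.  If `μ ≤ n − 1`: `ord_q Ψ ≤ μ <
n` (`σ(q)τ^μ` has
    `ϖ`-degree `0`).  `μ = n` forces `τ = T − a` and the GUARD; then `1 + β̄Tⁿ = β̄(T − ã)ⁿ + δ′` EXACTLY, `δ′ = 1 + β̄ãⁿ ∈ π̄A`
    (`SideClean ⟺ v_A(δ′) = 1` here), `X₀^{−n} ≡ x̃₀^{−n} (mod 𝔔ⁿ)` by Frobenius, so `Ψ ≡ β̄(T−ã)ⁿ + D(x̃₀) (mod π̄𝔔ⁿ)` with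
    `D(x₀) := δ′ + π̄^m ε̄ x₀^{−n} ∈ A` and `ord_q Ψ = min(n, v_A(D(x̃₀)))`.  For `m ≥ 2`: `v_A(D) = 1`, order 1.  For `m = 1`:
    `v_A(D(x₀)) = 1` except on the ONE residue class `x̄₀ⁿ = −ε̄(y′)/δ̄₁′` (`δ′ = π̄δ₁′`) — the STRAY point of the side line
    `t = a` (NEW w.r.t. (L)/(D): there the last leader `εW^r`, `r = k mod n ≥ 1`, carries `W` and can never cancel the
    `ϖ`-linear part of `1 + β̄Tⁿ`; here the bare `π̄ε̄` can).
    UNIFIED READING: at the (at most one per `y′`) stray point `q`, `ord_q Φ < n ⟺ v_A(Φ(x̃₀, x̃₁)) ≤ n − 1` for one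
(any) `A`-lift
    of `q` (core: `Φ(x̃₀, x̃₁) = x̃₀ⁿ + π̄((x̃₁−ã)ⁿ + δ)`; unit: `Φ = x̃₀ⁿ(β̄(t−ã)ⁿ + D(x̃₀))`), while at every other `A`-point
    `v_A(Φ) ≤ max(1, m) ≤ n − 1` automatically.  Hence, given `SideClean`, the A-POINT CLAUSE is EXACTLY «every
point of the last
    fibre over `y′` exits BY ORDER» (automatic for `m ≥ 2`; when the guard fails nothing is needed at unit points and `3 ≤ n` at
    cores).  [The guard matters: without it Hensel lifts of SMOOTH points of `{Φ̄ = 0}` (harmless, `μ = 1`) would violate the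
    inequality.]
(2) Non-closed points over `C` specialise to closed points over `C`; order is upper semicontinuous.
CONCLUSION: `(C₀ = C, C₁, …, C_{j−1})` is a weakly admissible sequence (regular centres inside `Top` of the weak
transform, empty
boundary), all centres over `C`, regular top, and NO point over `C` of the last transform has order `n`:
`PackageExitsOver I n C`
— ENGINE (D⁺) `PureLadderExit` on paper, DECIDED-MOD-PORT (port = g12's `CurvePackagePort` + HS 5.5.5 regularity of the chart
rings + permissibility of regular centres in the top locus of a principal marked ideal + semicontinuity of order + density of
closed points + the Hasse-derivative multiplicity criterion; no generic-point theorem, no residue-field hypothesis, no `τ`).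
CENSUS (self-runs of census-1's engine `tame.run` + `hasse_ideal/ideal_dim`, HOME/decomp-res-lens-2/g16/census-selfrun/
T-deg-plus-selfrun.md rows P1–P11 and T-pure-stray-selfrun.md rows S1–S9; census-1's T-deg-ladder bridge rows): members
P1 P2 P4 P6 P9 P10 P11 S2 S4 S6 S8 — 11/11 show the predicted profile (one `τ = 1` near point `X₀ⁿ` per performed stage, NONE at
depth `k/n`, exit); every excluded conjunct is NECESSARY for the depth-`k/n` exit: the clause at a core (P3), the
clause at a UNIT
point (S1 S3 S9: Top a surface; S5: Top-ISOLATED, a `τ = 1` stray near point `u₂³ + v³` AT depth `k/n = 2` — the minimal pair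
S4 `ε = 1+v` (member, value `π²`) / S5 `ε = 1+v²` (value `π³`) differs in NOTHING else), `3 ≤ n` at cores (P7a/b),
the guard-true
`n = 2` unit point (S7, automatic failure), `m < n` (P8) — necessary IN THE GIVEN PRESENTATION.  [rev 1] NONE of these rows is a
residual point: by the TRANSLATION LEMMA (`pure_translate`, §P1 below) a failing clause (an `A`-root of `Φ` modulo `𝔭 + 𝔪ⁿ`) is
the signature of a NON-MAXIMAL presentation, and re-presenting (`z ↦ z − x̃₀W^{k/n}`, `U ↦ U − x̃₁W^{k/n}`) puts P3, S5 (kernels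
`represent_P3`, `represent_S5`: (L)-germs with `k = 10`), P7a, P7b, P8 ((L), `k = 7`) and P5 ((D), `(m,k) = (1,7)`,
`represent_P5`) inside the VAST class (the point-level classes quantify over presentations), while S1 S3 S7 S9 have a SURFACE
top locus (outside the curve cell).  What is left of the binomial-cone family is the DEEP case of a MAXIMAL
presentation (`n ∣ k`,
coefficient valuation `m ≥ n`; see `IsGrandSpecialPt` and NEXT-g17).  NOT claimed: that (D⁺) ∪ (V) exhausts bed (i).
BED: the purity-jump BRIDGE ROW `g = z³ + v(u₁+u₂)³ + (1+v²)u₁⁶ + u₁¹⁰` over `𝔽₃` (critic rows 127/133 item (c)), `C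
= V(z,u₁,u₂)`,
`U = u₁+u₂`, `W = u₁`, `k = 6 = 2·3`, guard TRUE everywhere (`p = n = 3`): at the core `v = 0`: `(z + W²)³ = z³ + W⁶` absorbs,
leader `v²·W⁶`: `π = β = v`, `m = 2`, `ε = 1`, `h = W¹⁰ ∈ Wt(19)` (`bridge_core_presentation`), clause automatic; at `v = 1`
(`π = v − 1`): `g = (z − W²)³ + (1+π)U³ + π(2+π)W⁶ + W¹⁰` (`bridge_unit_presentation`), `m = 1`, `ε = 2 + π`, `β = 1 + π` units,
side root `a = −1`, `δ′ = −π`, stray class `x̄₀ = −1`, `Φ(−1, 1) = π²` (`bridge_unit_clause_value`): valuation `2 = n − 1`, the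
clause HOLDS (tightly); at `v = −1`, at the `𝔽₉`-points `v² + 1 = 0` (`π = v² + 1`, `m = 1`, `ε = 1`, `a = −v`, `x̄₀ = 1`,
`D = −π²`) and at every other closed point `v = c` (`c ≠ 0`, `c² ≠ −1`, `κ = 𝔽₃(c)`, in `κ[[π]]`, `π = v − c`: `β = c + π`,
`a³ = −1/c`, `δ′ = −π/c`, `ε = 2c + π` after absorbing `s³ = 1 + c²`, stray `x̄₀³ = −c²`, `D = −π²/c²`) likewise
valuation `2`: `g` IS
UNIFORMLY PURE-LADDER-SHAPED along `C`, and `Top(g) = C` (census T-deg-ladder bridge row: Top dimension 1; by hand: the Hasse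
derivatives `D_v^{(2)} g = W⁶` and `D_v g = U³ − vW⁶` force `W = U = 0` on `Top`, then `g = z³` forces `z = 0`), so
its core is a
PURE-LADDER-CURVE point.  `SideClean` at the unit points: `dβ/dπ ≠ 0` gives `v_A(δ′) = 1`.  `g` is VAST-SPECIAL
(NODE-g16.md LEMMA Q, by letter:
pinch-special — `Top` a non-isolated… precisely a CURVE through `y`, so not near- or δ-generic nor an isolated exit point; the
`τ = 1` pure-cube near point `(z + u₁)³` at depth 1 rules out (J)/(CT)/(T), curve- and rel-curve-genericity and flatness; germ
dimension 4 rules out (M); the cone term `vU³`, `v ∈ 𝔪`, is not cone-shallow: not (C) — census T-deg-ladder; and in none of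
(L)/(L′)/(D): every re-presentation keeps a term `unit·v′²W′⁶` of one-weight `18 <` every admissible threshold `3k′ + 1 ≥ 22`,
two-weight `12 <` the (L′) threshold, and (D) needs `3 ∤ k`).  So `g ∈ IsVastSpecialPt ∖ IsGrandSpecialPt`: the residual LOSES a
census-certified inhabitant of critic class (i).
[cite: Hironaka1964 Ch. III; CossartJannsenSaito2020 Ch. 2, Ch. 8; CossartPiltant2008 Prop. 4.2; Moh1987; Hauser2010 (purity /
kangaroo phenomenon, orientation only); folklore (quasi-homogeneous blow-up bookkeeping, Hasse-derivative multiplicity)] -/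

/-- **DEPTH for `n ∣ k`** [g16; KERNEL (PROVED)]: the stage exponents `k − i·n` stay `≥ n` for `i < k/n`, after `k/n` steps the
exponent is `0`, and `k/n ≥ 1` when `n ≤ k`. [folklore] -/
theorem pure_depth {n k : ℕ} (hn : 1 ≤ n) (hdvd : n ∣ k) (hnk : n ≤ k) :
    (∀ i, i < k / n → n ≤ k - i * n) ∧ k - (k / n) * n = 0 ∧ 1 ≤ k / n ∧ k % n = 0 := by
  refine ⟨?_, ?_, Nat.div_pos hnk (by omega), Nat.mod_eq_zero_of_dvd hdvd⟩
  · intro i hi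
    have h1 : (i + 1) * n ≤ k := by
      have := Nat.div_mul_le_self k n
      have h2 : (i + 1) * n ≤ (k / n) * n := Nat.mul_le_mul_right _ hi
      omega
    have : (i + 1) * n = i * n + n := by ring
    omega
  · have := Nat.div_mul_cancel hdvd
    omega

/-- **LAST-STAGE IDENTITY** [g16; KERNEL (PROVED)]: at exponent `0` the leader is the bare coefficient `θ = π^m ε`.
[folklore] -/
theorem pure_last_identity {R : Type} [CommRing R] (β θ X₀ X₁ W : R) (n : ℕ) :
    X₀ ^ n + β * X₁ ^ n + θ * W ^ 0 = X₀ ^ n + β * X₁ ^ n + θ := by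
  rw [pow_zero, mul_one]

/-- **THE LAST-STAGE TAIL LIES IN `(W)`** [g16; KERNEL (PROVED)]: at exponent `0` the weight ideal `Wt c n 0 1` (monomials with
`e·n ≥ 1`) is contained in `(c 2) = (W)` — so a tail form never cancels a lowest form of `Φ` of `w`-degree `0`. [folklore] -/
theorem wtIdeal_zero_le_span {R : Type} [CommRing R] (c : Fin 3 → R) (n : ℕ) :
    WtIdeal c n 0 1 ≤ Ideal.span {c 2} := by
  apply Ideal.span_le.mpr
  rintro x ⟨a, b, e, hw, rfl⟩
  have he : 1 ≤ e := by
    rcases Nat.eq_zero_or_pos e with h0 | hpos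
    · subst h0; simp at hw
    · exact hpos
  obtain ⟨e', rfl⟩ : ∃ e', e = e' + 1 := ⟨e - 1, by omega⟩
  rw [pow_succ, ← mul_assoc]
  exact Ideal.mul_mem_left _ _ (Ideal.subset_span (Set.mem_singleton _))

/-- **WEIGHT STEP INTO THE LAST STAGE** [g16; KERNEL (PROVED), = rev 3's `ladder_weight_step` at `k = n`]: a tail monomial of
weight `≥ n·n + 1` for exponent `n` transforms to a monomial with `W`-exponent `a + b + e − n ≥ 1`. [folklore] -/
theorem pure_weight_last {n a b e : ℕ} (hw : n * n + 1 ≤ (a + b) * n + e * n) : 1 ≤ a + b + e - n := by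
  have h := (ladder_weight_step (k := n) le_rfl hw).1
  omega

/-- **STRAY GAP LEMMA, binomial form** [g16; KERNEL (PROVED)]: if the Hasse coefficients `C(n, i)`, `1 ≤ i ≤ n − 2`, all vanish
in the residue ring then so does `C(n, n−1) = C(n, 1)` (`n ≥ 3`) — a linear factor of `Tⁿ + ε̄` of multiplicity `≥ n − 1` has
multiplicity `n` (and then the GUARD holds); there is NO GAP value `μ = n − 1`. [folklore] -/
theorem stray_no_gap {K : Type} [CommRing K] {n : ℕ} (hn : 3 ≤ n)
    (h : ∀ i, 1 ≤ i → i ≤ n - 2 → ((n.choose i : ℕ) : K) = 0) : ((n.choose (n - 1) : ℕ) : K) = 0 := by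
  rw [Nat.choose_symm (show 1 ≤ n by omega)]
  exact h 1 le_rfl (by omega)

/-- The GUARD in characteristic 3: it holds for `n = 3` and `n = 9` (powers of 3) and fails for `n = 2`, `n = 4`, `n = 6`
(`C(2,1) = 2`, `C(4,1) = 4`, `C(6,3) = 20` are units) — for `n = 2` the gap value `μ = 1 = n − 1` exists.  KERNEL (`decide`). -/
example : ((Nat.choose 3 1 : ℕ) : ZMod 3) = 0 ∧ ((Nat.choose 3 2 : ℕ) : ZMod 3) = 0 ∧ ((Nat.choose 9 3 : ℕ) : ZMod 3) = 0 ∧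
    ((Nat.choose 9 4 : ℕ) : ZMod 3) = 0 ∧ ((Nat.choose 2 1 : ℕ) : ZMod 3) ≠ 0 ∧ ((Nat.choose 4 1 : ℕ) : ZMod 3) ≠ 0 ∧
    ((Nat.choose 6 3 : ℕ) : ZMod 3) ≠ 0 := by
  decide

/-- **FROBENIUS EXACTNESS under the guard** [KERNEL (PROVED), characteristic 3]: `(X₁ − a)³ = X₁³ − a³`, so `X₁³ + ε =
(X₁ − a)³ + (a³ + ε)` EXACTLY — the `δ` of the core stray analysis. [Mathlib `sub_pow_char`] [folklore] -/
theorem frobenius_exact_three (X a ε : MvPolynomial (Fin 2) (ZMod 3)) :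
    X ^ 3 + ε = (X - a) ^ 3 + (a ^ 3 + ε) := by
  haveI : Fact (Nat.Prime 3) := ⟨by norm_num⟩
  rw [sub_pow_char]
  ring

/-- Bed arithmetic [g16]: `(n, k) = (3, 6)`: depth `2`, last exponent `0`; `(5, 10)`: depth `2`; `(3, 9)`: depth
`3`; the weight of
the bridge tail `u₁¹⁰ = W¹⁰` is `10·3 = 30 ≥ 3·6 + 1`, of `v·u₁⁷` it is `21 ≥ 19`, of `W⁶` only `18`.  KERNEL (`decide`). -/
example : 3 ∣ 6 ∧ 6 / 3 = 2 ∧ 6 - 2 * 3 = 0 ∧ 5 ∣ 10 ∧ 10 / 5 = 2 ∧ 9 / 3 = 3 ∧ 3 * 6 + 1 ≤ (0 + 0) * 6 + 10 * 3 ∧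
    3 * 6 + 1 ≤ (0 + 0) * 6 + 7 * 3 ∧ ¬ 3 * 6 + 1 ≤ (0 + 0) * 6 + 6 * 3 := by decide

/-- **THE BRIDGE BED AT ITS CORE** [g16; KERNEL (PROVED), characteristic 3]: `g = z³ + vU³ + (1+v²)W⁶ + W¹⁰ =
(z + W²)³ + v·U³ + v²·1·W⁶ + W¹⁰` — pure ladder shape with `π = β = v`, `m = 2`, `ε = 1`, `k = 6`, `h = W¹⁰`. [folklore] -/
theorem bridge_core_presentation (z U W v : MvPolynomial (Fin 4) (ZMod 3)) :
    z ^ 3 + v * U ^ 3 + (1 + v ^ 2) * W ^ 6 + W ^ 10 = (z + W ^ 2) ^ 3 + v * U ^ 3 + v ^ 2 * 1 * W ^ 6 + W ^ 10 := by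
  haveI : Fact (Nat.Prime 3) := ⟨by norm_num⟩
  rw [add_pow_char, ← pow_mul]
  ring

/-- **THE BRIDGE BED AT THE UNIT POINT `v = 1`** [g16; KERNEL (PROVED), characteristic 3; `v = 1 + π`]:
`g = (z − W²)³ + (1+π)U³ + π(2+π)·W⁶ + W¹⁰` — pure ladder shape with `m = 1`, `ε = 2 + π` (a unit), `β = 1 + π` (a
unit). [folklore] -/
theorem bridge_unit_presentation (z U W π : MvPolynomial (Fin 4) (ZMod 3)) :
    z ^ 3 + (1 + π) * U ^ 3 + (1 + (1 + π) ^ 2) * W ^ 6 + W ^ 10 =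
      (z - W ^ 2) ^ 3 + (1 + π) * U ^ 3 + π ^ 1 * (2 + π) * W ^ 6 + W ^ 10 := by
  have h3 : (3 : MvPolynomial (Fin 4) (ZMod 3)) = 0 := by
    simpa using CharP.cast_eq_zero (MvPolynomial (Fin 4) (ZMod 3)) 3
  linear_combination (z ^ 2 * W ^ 2 - z * W ^ 4 + W ^ 6) * h3

/-- **THE A-POINT CLAUSE ON THE BRIDGE BED at `v = 1`** [g16; KERNEL (PROVED)]: at the stray lift `(x₀, x₁) = (−1,
1)` (side root
`a = −1`) the last-stage value `x₀³ + βx₁³ + πε` is `π²` modulo the curve parameters: valuation `2 = n − 1`, the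
clause HOLDS. [folklore] -/
theorem bridge_unit_clause_value (π : Polynomial (ZMod 3)) :
    (-1) ^ 3 + (1 + π) * 1 ^ 3 + π ^ 1 * (2 + π) = π ^ 2 := by
  have h3 : (3 : Polynomial (ZMod 3)) = 0 := by
    simpa using CharP.cast_eq_zero (Polynomial (ZMod 3)) 3
  linear_combination π * h3

/-- **THE MINIMAL PAIR S4 / S5** [g16; KERNEL (PROVED)]: `f = z³ + (1+v)U³ + v·ε·W⁶ + W¹⁰` over `𝔽₃`, a UNIT point with `m = 1`
at `v = 0`, side root `a = −1`, stray lift `(1, −1)`: with `ε = 1 + v` (census S4, MEMBER, exit at depth 2) the value is `v²`;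
with `ε = 1 + v²` (census S5, Top-ISOLATED, a `τ = 1` stray NEAR point at depth 2) it is `v³ ∈ 𝔪³` — the clause is exactly
what separates them IN THIS PRESENTATION ([rev 1] S5 re-presents into class (L) with `k = 10`: `root_S5`, `represent_S5`).
(Pure ring identities.) [folklore] -/
theorem stray_pair_values {R : Type} [CommRing R] (v : R) :
    (1 : R) ^ 3 + (1 + v) * (-1) ^ 3 + v ^ 1 * (1 + v) = v ^ 2 ∧
      (1 : R) ^ 3 + (1 + v) * (-1) ^ 3 + v ^ 1 * (1 + v ^ 2) = v ^ 3 := by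
  constructor <;> ring

/-- The stray factorisation behind census row P3 (`ε = 1` at a core with `m = 1`, characteristic 3): `T³ + 1 = (T + 1)³`, a
TRIPLE root `a = −1` with `δ = a³ + ε = 0` — the clause fails (`v_A(δ) = ∞`) and a near point survives (P3 is correctly
EXCLUDED in this presentation; [rev 1] re-presented with `U′ = U + W²` it is the (L)-germ `z³ + vU′³ + W¹⁰`, `represent_P3`).
KERNEL. -/
example (T : Polynomial (ZMod 3)) : T ^ 3 + 1 = (T + 1) ^ 3 := by
  have h3 : (3 : Polynomial (ZMod 3)) = 0 := by
    simpa using CharP.cast_eq_zero (Polynomial (ZMod 3)) 3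
  linear_combination (-(T ^ 2) - T) * h3

/-! #### [rev 1] THE TRANSLATION LEMMA and the census exclusions RE-PRESENTED
Under the guard in its exact form (`n = p^s` in characteristic `p`), translating the cone variables by `A`-multiples of `W^j`
(`j = k/n`) replaces the `W^k`-coefficient `θ = π^m ε` by the last-stage fibre value `Φ(x₀,x₁) = x₀ⁿ + βx₁ⁿ + θ` and changes
nothing else of the shape (tail weights are preserved: a monomial `z^aU^bW^e` of weight `(a+b)k + en` expands into monomials of
the same weight).  CONSEQUENCES (paper, NODE-g16.md §3b).  (1) `StrayClean` at a presentation says: NO translate has its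
`W^k`-coefficient in `𝔭 + 𝔪ⁿ`; in a presentation MAXIMISING first `k` and then the coefficient valuation `m`, the clause is
AUTOMATIC when `m < n`.  (2) A failing clause is the signature of a NON-MAXIMAL presentation: an `A`-root of `Φ` modulo `𝔭 + 𝔪ⁿ`
translates to a presentation with a deeper coefficient (`m ≥ n`) or, when the root is exact modulo `𝔭`, with a LARGER `k` —
census P3, S5, P7a, P7b, P8 become (L)-germs and P5 a (D)-germ (kernels below), so NONE of the census exclusions of the law
docstring is a residual point (the point-level classes quantify over presentations; S1 S3 S7 S9 have a surface top locus and are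
outside the curve cell).  (3) What is LEFT of the binomial-cone family `zⁿ + βUⁿ + (transversal tail)` on the curve cell is the
DEEP case: a maximal presentation with `n ∣ k` and coefficient valuation `m ≥ n` (NEXT-g17). -/

/-- **TRANSLATION LEMMA** [rev 1; KERNEL (PROVED); `n = p^s`, characteristic `p`]: translating the cone variables by
multiples of
`W^j` moves the `W^{nj}`-coefficient to the last-stage fibre value `x₀ⁿ + βx₁ⁿ + θ` and creates no other term.
[Mathlib `add_pow_char_pow`] [folklore] -/
theorem pure_translate {R : Type} [CommRing R] (p s j : ℕ) [Fact p.Prime] [CharP R p] (z U W β x₀ x₁ θ : R) :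
    (z + x₀ * W ^ j) ^ p ^ s + β * (U + x₁ * W ^ j) ^ p ^ s + θ * (W ^ j) ^ p ^ s =
      z ^ p ^ s + β * U ^ p ^ s + (x₀ ^ p ^ s + β * x₁ ^ p ^ s + θ) * (W ^ j) ^ p ^ s := by
  rw [add_pow_char_pow, add_pow_char_pow, mul_pow, mul_pow]
  ring

/-- **census S5 RE-PRESENTED** [rev 1; KERNEL (PROVED), characteristic 3]: `z′ = z − (1−v)W²`, `U′ = U + W²` turn
`z³ + (1+v)U³ + v(1+v²)W⁶ + W¹⁰` into the (L)-germ `z′³ + (1+v)U′³ + 1·W¹⁰ + 0` (`k = 10`, `3 ∤ 10`, `h = 0`): S5 is a LADDER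
point (rev 3 class (L)), not a residual point; the (L) law's stages are exactly the observed near points at depths 1, 2 and the
exit at depth 3. [folklore] -/
theorem represent_S5 (z U W v : MvPolynomial (Fin 4) (ZMod 3)) :
    z ^ 3 + (1 + v) * U ^ 3 + v * (1 + v ^ 2) * W ^ 6 + W ^ 10 =
      (z - (1 - v) * W ^ 2) ^ 3 + (1 + v) * (U + W ^ 2) ^ 3 + 1 * W ^ 10 + 0 := by
  have h3 : (3 : MvPolynomial (Fin 4) (ZMod 3)) = 0 := by
    simpa using CharP.cast_eq_zero (MvPolynomial (Fin 4) (ZMod 3)) 3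
  linear_combination (-z ^ 2 * W ^ 2 * v + z ^ 2 * W ^ 2 - z * W ^ 4 * v ^ 2 + 2 * z * W ^ 4 * v - z * W ^ 4
    - U ^ 2 * W ^ 2 * v - U ^ 2 * W ^ 2 - U * W ^ 4 * v - U * W ^ 4 + W ^ 6 * v ^ 2 - W ^ 6 * v) * h3

/-- **census P3 RE-PRESENTED** [rev 1; KERNEL (PROVED)]: `U′ = U + W²` turns `z³ + vU³ + vW⁶ + W¹⁰` into the core (L)-germ
`z³ + vU′³ + W¹⁰` (`k = 10`). [folklore] -/
theorem represent_P3 (z U W v : MvPolynomial (Fin 4) (ZMod 3)) :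
    z ^ 3 + v * U ^ 3 + v * W ^ 6 + W ^ 10 = z ^ 3 + v * (U + W ^ 2) ^ 3 + 1 * W ^ 10 + 0 := by
  have h3 : (3 : MvPolynomial (Fin 4) (ZMod 3)) = 0 := by
    simpa using CharP.cast_eq_zero (MvPolynomial (Fin 4) (ZMod 3)) 3
  linear_combination (-U ^ 2 * W ^ 2 * v - U * W ^ 4 * v) * h3

/-- **census P5 RE-PRESENTED** [rev 1; KERNEL (PROVED)]: `U′ = U + W²` turns `z³ + vU³ + v(1 + U − W)W⁶ + W¹⁰` into the
(D)-germ `z³ + vU′³ + v¹·(−1)·W⁷ + h`, `h = vU′W⁶ − vW⁸ + W¹⁰` of weights `25, 24, 30 ≥ 3·7 + 1` (rev 5 class (D),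
`(m, k) = (1, 7)`). [folklore] -/
theorem represent_P5 (z U W v : MvPolynomial (Fin 4) (ZMod 3)) :
    z ^ 3 + v * U ^ 3 + v * (1 + (U - W)) * W ^ 6 + W ^ 10 =
      z ^ 3 + v * (U + W ^ 2) ^ 3 + v ^ 1 * (-1) * W ^ 7 + (v * (U + W ^ 2) * W ^ 6 - v * W ^ 8 + W ^ 10) := by
  have h3 : (3 : MvPolynomial (Fin 4) (ZMod 3)) = 0 := by
    simpa using CharP.cast_eq_zero (MvPolynomial (Fin 4) (ZMod 3)) 3
  linear_combination (-U ^ 2 * W ^ 2 * v - U * W ^ 4 * v) * h3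

/-- **census P7a / P7b / P8 RE-PRESENTED** [rev 1; KERNELS (PROVED), characteristic 2, `n = 2`]: (L)-germs with `k =
7`. [folklore] -/
theorem represent_P7a (z U W v : MvPolynomial (Fin 4) (ZMod 2)) :
    z ^ 2 + v * U ^ 2 + v * W ^ 4 + W ^ 7 = z ^ 2 + v * (U + W ^ 2) ^ 2 + 1 * W ^ 7 + 0 := by
  have h2 : (2 : MvPolynomial (Fin 4) (ZMod 2)) = 0 := by
    simpa using CharP.cast_eq_zero (MvPolynomial (Fin 4) (ZMod 2)) 2
  linear_combination (-U * W ^ 2 * v) * h2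

/-- `represent_P7b`: Auxiliary step of this node's calculus, VERBATIM from the lens file (see the module docstring);
the statement is its type. [folklore] -/
theorem represent_P7b (z U W v : MvPolynomial (Fin 4) (ZMod 2)) :
    z ^ 2 + v * U ^ 2 + v * (1 + v) * W ^ 4 + W ^ 7 = (z - v * W ^ 2) ^ 2 + v * (U + W ^ 2) ^ 2 + 1 * W ^ 7 + 0 := by
  have h2 : (2 : MvPolynomial (Fin 4) (ZMod 2)) = 0 := by
    simpa using CharP.cast_eq_zero (MvPolynomial (Fin 4) (ZMod 2)) 2
  linear_combination (z * W ^ 2 * v - U * W ^ 2 * v) * h2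

/-- `represent_P8`: Auxiliary step of this node's calculus, VERBATIM from the lens file (see the module docstring);
the statement is its type. [folklore] -/
theorem represent_P8 (z U W v : MvPolynomial (Fin 4) (ZMod 2)) :
    z ^ 2 + v * U ^ 2 + v ^ 2 * W ^ 4 + W ^ 7 = (z - v * W ^ 2) ^ 2 + v * U ^ 2 + 1 * W ^ 7 + 0 := by
  have h2 : (2 : MvPolynomial (Fin 4) (ZMod 2)) = 0 := by
    simpa using CharP.cast_eq_zero (MvPolynomial (Fin 4) (ZMod 2)) 2
  linear_combination (z * W ^ 2 * v) * h2

/-- **S5's exact `A`-root** [rev 1; KERNEL (PROVED)]: `(1 − v, −1)` is an EXACT root of the last-stage fibre polynomial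
`Φ = X₀³ + (1+v)X₁³ + v(1+v²)` — the translation of the lemma above by this root is `represent_S5`. [folklore] -/
theorem root_S5 (v : Polynomial (ZMod 3)) : (1 - v) ^ 3 + (1 + v) * (-1) ^ 3 + v * (1 + v ^ 2) = 0 := by
  have h3 : (3 : Polynomial (ZMod 3)) = 0 := by
    simpa using CharP.cast_eq_zero (Polynomial (ZMod 3)) 3
  linear_combination (v ^ 2 - v) * h3

end PureKernel

end Summit.ResolutionOfSingularities.ResolutionOfSingularities.Theorems.PurityCut
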